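import Literature.NumberTheory.GaloisRepresentations.PstWeilDeligneDualDeRham
import Literature.NumberTheory.PAdicHodge.DualExpElliptic
import Literature.NumberTheory.EllipticCurves.TateModuleFinrankProofs
import Literature.NumberTheory.EllipticCurves.TateModuleFinite
import HarnessLib

/-!
# Admissibility (de Rham-ness) from equivariant PERIOD HOMOMORPHISMS

Topic `Literature/NumberTheory/PAdicHodge`; §1 extends the tree structure `PeriodRingData` (namespace
`Literature.NumberTheory.GaloisRepresentations.PeriodRingData`), §2 lives in `Literature.NumberTheory.PAdicHodge`.
THEOREMS ONLY (no definition, no named fact, no instance, no `sorry`).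

Fontaine's formalism (Astérisque 223, Exp. III §1.4–1.5) is phrased in the tree with INVARIANT VECTORS of `B ⊗_{ℚ_p} V`
(`PeriodRingData.D`, `linearIndependent_of_mem_D`, `isAdmissible_of_periodMatrix`). The `p`-adic periods of a geometric
object arrive instead as `Γ`-EQUIVARIANT FUNCTIONALS `φ : V → B`, `φ(ρ(σ) v) = σ(φ v)` — for an elliptic curve the two
"integrals" `τ ↦ ∫_τ ω`, `τ ↦ ∫_τ η` on the Tate module (Fontaine 1982 §5, Colmez 1992 §2; tree: `omegaPeriodHom`,
`etaPeriodHom` on `TatePt`), i.e. elements of `D_B(V^*) = Hom_{ℚ_p[Γ]}(V, B)`. This file proves the functional form of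
Fontaine's criterion for an arbitrary period-ring datum `𝔅` over `(Γ, P, E)`, and its elliptic specialisation:

* `PeriodRingData.linearIndependent_of_equivariant` — equivariant functionals linearly independent over `E = B^Γ` are
  linearly independent over `B` (injectivity of the comparison map for `V^*`; functional twin of `linearIndependent_of_mem_D`).
* `PeriodRingData.isAdmissible_of_equivariant` — **`dim_P V` equivariant functionals, `E`-linearly independent, make `V`
  admissible**: their matrix `H = (φ_i(v_j))` in a `P`-basis satisfies `σ(H) = H · R(σ)`, `det H ≠ 0` (previous point), so
  `det H` is a unit by regularity (iii) and `H⁻¹` is a period matrix for `isAdmissible_of_periodMatrix` — no duality needed.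
* `PeriodRingData.isAdmissible_of_pair_of_fil` — `dim_P V = 2`, `φ₁ ≠ 0` with values in `Fil^i B`, `φ₂` with a value
  outside `Fil^i B` ⇒ admissible (the shape of the de Rham comparison for a `p`-divisible group of height 2, dimension 1).
* §2 `isAdmissible_rationalTateModule_of_periodHoms`, `isDeRham_rationalTateRep_of_periodHoms`,
  `isDeRham_restrictedRationalTateRep_of_periodHoms` — ELLIPTIC SPECIALISATION in the vocabulary of the cite-only fact
  `isDeRham_restrictedRationalTateRep` (file `DualExpElliptic`): two additive, `ℤ_p`-homogeneous, `Γ_F`-equivariant maps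
  `φ₁ φ₂ : T_p → B_dR(F)` with `φ₁ ≠ 0`, `φ₁(T_p) ⊆ Fil¹`, `φ₂(τ) ∉ Fil¹` for some `τ` make `V_p` de Rham for
  `bdRPeriodRingData hp` (extension to `V_p = ℚ_p ⊗_{ℤ_p} T_p` by `LinearMap.liftBaseChange`; `dim V_p = 2` is the tree
  theorem `finrank_rationalTateModule_eq_two_holds`). Assembly step (A6) of the road "hDR at supersingular reduction via
  the two `p`-adic periods" (BSD route EdixhovenFibreFiveSeven, crux K★); the periods, their `ℤ_p`-linearity and the matching
  `T_pŴ ≅ T_pE` are separate tree files, NOT used here. BSD is not proved by this; the cite-only hDR fact stays cite-only.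

## References
* [FontaineAsterisque223III] J.-M. Fontaine, *Représentations p-adiques semi-stables*, Astérisque 223 (1994), Exp. III,
  Prop. 1.4.2, §1.5 (Prop. 1.5.2, Thm. 1.5.2).
* [FontaineOuyang2022] J.-M. Fontaine, Y. Ouyang, *Theory of p-adic Galois representations*, Thm. 2.13, Thm. 3.14.
* [Fontaine1982FormesDifferentielles] J.-M. Fontaine, Invent. Math. 65 (1982), §5 (the period pairing, `V_pA` de Rham).
* [SilvermanAEC2009] J. H. Silverman, *The Arithmetic of Elliptic Curves*, III.7.1 (`dim V_pE = 2`).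
-/

noncomputable section

open Matrix
open scoped TensorProduct

/-! ## §1 Equivariant functionals on a representation with values in a period ring -/

namespace Literature.NumberTheory.GaloisRepresentations.PeriodRingData

section PeriodHoms

-- Mathlib's own global value of `maxSynthPendingDepth` (see `PeriodRingData.finrank_D_le_holds`).
set_option maxSynthPendingDepth 3

universe u v v' w w'

variable {Γ : Type u} [Group Γ] [TopologicalSpace Γ] {P : Type v} {E : Type v'} [Field P]
  [TopologicalSpace P] [Field E] [Algebra P E]
  {M : Type w'} [AddCommGroup M] [Module P M] [TopologicalSpace M]
  (𝔅 : PeriodRingData.{u, v, v', w} Γ P E) (ρ : ContinuousRep Γ P M)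

/-- Transport of structure for an equivariant functional: if `φ (ρ σ m) = σ • φ m` for all `σ, m`, then a `B`-linear
relation `∑ cᵢ φᵢ = 0` is carried to the relation `∑ σ(cᵢ) φᵢ = 0` (apply `σ` to the relation evaluated at `ρ(σ⁻¹) m`).
[cite: FontaineAsterisque223III, Exp. III §1.4] -/
theorem sum_smul_smul_eq_zero_of_equivariant {ι : Type*} {Φ : ι → (M →ₗ[P] 𝔅.B)}
    (hΦ : ∀ i σ m, Φ i (ρ σ m) = σ • Φ i m) (s : Finset ι) (c : ι → 𝔅.B)
    (hc : ∑ i ∈ s, c i • Φ i = 0) (σ : Γ) : ∑ i ∈ s, (σ • c i) • Φ i = 0 := by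
  ext m
  have hm : ρ σ (ρ σ⁻¹ m) = m := by
    rw [← Module.End.mul_apply, ← map_mul, mul_inv_cancel, map_one, Module.End.one_apply]
  have h0 := congrArg (fun f : M →ₗ[P] 𝔅.B => σ • f (ρ σ⁻¹ m)) hc
  simp only [LinearMap.coe_sum, Finset.sum_apply, LinearMap.smul_apply, LinearMap.zero_apply, smul_zero,
    Finset.smul_sum, smul_eq_mul] at h0 ⊢
  rw [← h0]
  refine Finset.sum_congr rfl fun i _ => ?_
  rw [smul_mul', ← hΦ i σ, hm]

/-- **Equivariant functionals: `E`-linearly independent ⇒ `B`-linearly independent** (injectivity of Fontaine's comparison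
map for `Hom_{P[Γ]}(V, B) = D_B(V^*)`; functional twin of `linearIndependent_of_mem_D`, same proof): strong induction on the
support of a `B`-relation `∑ cᵢ φᵢ = 0` with `c_j ≠ 0`; conjugating by `σ` and eliminating `φ_j` gives a shorter relation,
whence `c_j σ(cᵢ) = σ(c_j) cᵢ`; regularity (ii) gives `cᵢ = eᵢ c_j`, `eᵢ ∈ E`, so `∑ eᵢ φᵢ = 0` (`B` a domain), `c_j = 0`.
[cite: FontaineAsterisque223III, Exp. III Prop. 1.4.2 and Thm. 1.5.2] [cite: FontaineOuyang2022, Thm. 3.14] -/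
theorem linearIndependent_of_equivariant {ι : Type*} {Φ : ι → (M →ₗ[P] 𝔅.B)}
    (hΦ : ∀ i σ m, Φ i (ρ σ m) = σ • Φ i m) (hli : LinearIndependent E Φ) :
    LinearIndependent 𝔅.B Φ := by
  classical
  rw [linearIndependent_iff'] at hli ⊢
  intro s
  induction s using Finset.strongInduction with
  | H s ih =>
    intro c hc
    by_contra! hne
    obtain ⟨j, hjs, hj⟩ := hne
    -- Step 1: the quotients `c i / c j` are `Γ`-invariant (shorter relation + induction).
    have key : ∀ σ : Γ, ∀ i ∈ s, c j * σ • c i = σ • c j * c i := by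
      intro σ
      have hσ : ∑ i ∈ s, (σ • c i) • Φ i = 0 := 𝔅.sum_smul_smul_eq_zero_of_equivariant ρ hΦ s c hc σ
      have hj0 : (c j * σ • c j - σ • c j * c j) • Φ j = 0 := by
        rw [mul_comm, sub_self, zero_smul]
      have hsum : ∑ i ∈ s.erase j, (c j * σ • c i - σ • c j * c i) • Φ i = 0 := by
        rw [Finset.sum_erase s hj0]
        simp only [sub_smul, Finset.sum_sub_distrib, mul_smul, ← Finset.smul_sum, hc, hσ,
          smul_zero, sub_self]
      have h' := ih (s.erase j) (Finset.erase_ssubset hjs) _ hsum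
      intro i hi
      by_cases hij : i = j
      · subst hij; exact mul_comm _ _
      · exact sub_eq_zero.mp (h' i (Finset.mem_erase.mpr ⟨hij, hi⟩))
    -- Step 2: regularity (ii) gives `c i = e i • c j` with `e i ∈ E`.
    have he : ∀ i ∈ s, ∃ e : E, c i = e • c j := fun i hi =>
      𝔅.exists_smul_eq (c i) (c j) hj fun σ => by
        rw [mul_comm (σ • c i), key σ i hi, mul_comm]
    choose! e he using he
    -- Step 3: `c j • ∑ e i • Φ i = 0`, hence `∑ e i • Φ i = 0` (`B` is a domain); then `e j = 0`, so `c j = 0`.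
    have hsum : c j • ∑ i ∈ s, e i • Φ i = 0 := by
      rw [Finset.smul_sum, ← hc]
      refine Finset.sum_congr rfl fun i hi => ?_
      rw [← smul_comm (e i) (c j) (Φ i), ← smul_assoc, ← he i hi]
    have hsum' : ∑ i ∈ s, e i • Φ i = 0 := by
      ext m
      have h := congrArg (fun f : M →ₗ[P] 𝔅.B => f m) hsum
      simp only [LinearMap.smul_apply, LinearMap.zero_apply, smul_eq_mul, mul_eq_zero] at h
      exact h.resolve_left hj
    have hej : e j = 0 := hli s e hsum' j hjs
    exact hj (by rw [he j hjs, hej, zero_smul])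

/-- The matrix of a family of equivariant functionals in a basis transforms by the matrix of the representation:
`σ(φᵢ(v_j)) = ∑_k φᵢ(v_k) R(σ)_{kj}`, i.e. `σ(H) = H · R(σ)`. [cite: FontaineAsterisque223III, Exp. III §1.5] -/
theorem smul_apply_basis_of_equivariant {ι : Type*} [Fintype ι] [DecidableEq ι] (v : Module.Basis ι P M)
    {φ : M →ₗ[P] 𝔅.B} (hφ : ∀ σ m, φ (ρ σ m) = σ • φ m) (σ : Γ) (j : ι) :
    σ • φ (v j) = ∑ k, φ (v k) * algebraMap P 𝔅.B (LinearMap.toMatrix v v (ρ σ) k j) := by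
  rw [← hφ σ (v j)]
  conv_lhs => rw [← v.sum_repr (ρ σ (v j))]
  rw [map_sum]
  refine Finset.sum_congr rfl fun k _ => ?_
  rw [map_smul, LinearMap.toMatrix_apply, Algebra.smul_def, mul_comm]

/-- **Admissibility from `dim V` independent equivariant functionals** (functional form of Fontaine's criterion): `ρ` on
`V` with `dim_P V = n`, `φ₀, …, φ_{n-1} : V → B` `P`-linear, `Γ`-equivariant and `E`-linearly independent ⇒ `V` is
`𝔅`-admissible. Proof: in a `P`-basis the matrix `H = (φᵢ(v_j))` has `σ(H) = H · R(σ)` (`smul_apply_basis_of_equivariant`)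
and `det H ≠ 0` (`linearIndependent_of_equivariant`, `Matrix.exists_vecMul_eq_zero_iff`); `σ(det H) = det R(σ) · det H`, so
`det H` is a unit by regularity (iii); `C = H⁻¹` has `R(σ) · σ(C) = C` and `isAdmissible_of_periodMatrix` concludes.
[cite: FontaineAsterisque223III, Exp. III Prop. 1.5.2 and Thm. 1.5.2] [cite: FontaineOuyang2022, Thm. 2.13] -/
theorem isAdmissible_of_equivariant [FiniteDimensional P M] {n : ℕ} (hn : Module.finrank P M = n)
    {Φ : Fin n → (M →ₗ[P] 𝔅.B)} (hΦ : ∀ i σ m, Φ i (ρ σ m) = σ • Φ i m)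
    (hli : LinearIndependent E Φ) : 𝔅.IsAdmissible ρ := by
  classical
  let v : Module.Basis (Fin n) P M := Module.finBasisOfFinrankEq P M hn
  let H : Matrix (Fin n) (Fin n) 𝔅.B := Matrix.of fun i j => Φ i (v j)
  let R : Γ → Matrix (Fin n) (Fin n) P := fun σ => LinearMap.toMatrix v v (ρ σ)
  let g : Γ → 𝔅.B →+* 𝔅.B := fun σ => MulSemiringAction.toRingHom Γ 𝔅.B σ
  have hliB : LinearIndependent 𝔅.B Φ := 𝔅.linearIndependent_of_equivariant ρ hΦ hli
  -- (1) `det H ≠ 0`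
  have hdet : H.det ≠ 0 := by
    intro h0
    obtain ⟨c, hc0, hc⟩ := Matrix.exists_vecMul_eq_zero_iff.2 h0
    have hrel : ∑ i, c i • Φ i = 0 := by
      refine v.ext fun j => ?_
      have hj : ∑ i, c i * H i j = 0 := by
        have h := congrFun hc j
        simpa only [Matrix.vecMul, dotProduct, Pi.zero_apply] using h
      simpa only [LinearMap.coe_sum, Finset.sum_apply, LinearMap.smul_apply, smul_eq_mul, LinearMap.zero_apply,
        H, Matrix.of_apply] using hj
    exact hc0 (funext fun i => Fintype.linearIndependent_iff.1 hliB c hrel i)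
  -- (2) `σ(H) = H · R(σ)`
  have hσH : ∀ σ, (g σ).mapMatrix H = H * (R σ).map (algebraMap P 𝔅.B) := fun σ => by
    ext i j
    rw [RingHom.mapMatrix_apply, Matrix.map_apply, Matrix.mul_apply]
    simp only [H, Matrix.of_apply, Matrix.map_apply, g, MulSemiringAction.toRingHom_apply]
    exact 𝔅.smul_apply_basis_of_equivariant ρ v (hΦ i) σ j
  -- (3) `det H` is a unit (regularity (iii))
  have hunit : IsUnit H.det := by
    refine 𝔅.isUnit_of_smul_mem H.det hdet fun σ => ⟨(R σ).det, ?_⟩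
    have h1 : σ • H.det = (g σ) H.det := rfl
    rw [h1, RingHom.map_det, hσH σ, Matrix.det_mul, ← RingHom.mapMatrix_apply, ← RingHom.map_det,
      𝔅.algebraMap_eq, mul_comm]
  -- (4) the period matrix `C = H⁻¹`
  have hgC : ∀ σ, σ • H⁻¹ = (g σ).mapMatrix H⁻¹ := fun σ => by
    ext i j
    rw [RingHom.mapMatrix_apply, Matrix.map_apply, Matrix.smul_apply]
    rfl
  refine 𝔅.isAdmissible_of_periodMatrix ρ v H⁻¹ (Matrix.isUnit_nonsing_inv_det_iff.2 hunit) fun σ => ?_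
  rw [hgC σ]
  calc (R σ).map (algebraMap P 𝔅.B) * (g σ).mapMatrix H⁻¹
      = H⁻¹ * H * ((R σ).map (algebraMap P 𝔅.B) * (g σ).mapMatrix H⁻¹) := by
        rw [Matrix.nonsing_inv_mul H hunit, Matrix.one_mul]
    _ = H⁻¹ * (g σ).mapMatrix (H * H⁻¹) := by
        rw [map_mul, hσH σ, Matrix.mul_assoc, Matrix.mul_assoc]
    _ = H⁻¹ := by rw [Matrix.mul_nonsing_inv H hunit, map_one, Matrix.mul_one]

omit [TopologicalSpace Γ] [TopologicalSpace P] [TopologicalSpace M] in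
/-- Two functionals separated by a filtration step are `E`-linearly independent: if `φ₁ ≠ 0` takes its values in the
`E`-submodule `Fil^i B` and `φ₂` takes some value outside `Fil^i B`, then `s φ₁ + t φ₂ = 0` with `s, t ∈ E` forces
`s = t = 0`. (The shape of the de Rham comparison for a `p`-divisible group of dimension 1 and height 2: `∫ω ∈ Fil¹`,
`∫η ∉ Fil¹`.) [cite: Fontaine1982FormesDifferentielles, §5] -/
theorem linearIndependent_pair_of_fil {φ₁ φ₂ : M →ₗ[P] 𝔅.B} {i : ℤ}
    (hfil : ∀ m, φ₁ m ∈ 𝔅.fil i) (hne : φ₁ ≠ 0) (hnot : ∃ m, φ₂ m ∉ 𝔅.fil i) :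
    LinearIndependent E ![φ₁, φ₂] := by
  obtain ⟨m₀, hm₀⟩ := hnot
  refine LinearIndependent.pair_iff.2 fun s t hst => ?_
  have ht : t = 0 := by
    by_contra ht
    apply hm₀
    have h := congrArg (fun f : M →ₗ[P] 𝔅.B => f m₀) hst
    simp only [LinearMap.add_apply, LinearMap.smul_apply, LinearMap.zero_apply] at h
    have h2 : t • φ₂ m₀ = -(s • φ₁ m₀) := eq_neg_of_add_eq_zero_right h
    have h3 : φ₂ m₀ = t⁻¹ • -(s • φ₁ m₀) := by rw [← h2, smul_smul, inv_mul_cancel₀ ht, one_smul]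
    rw [h3]
    exact (𝔅.fil i).smul_mem _ ((𝔅.fil i).neg_mem ((𝔅.fil i).smul_mem _ (hfil m₀)))
  subst ht
  rw [zero_smul, add_zero] at hst
  refine ⟨?_, rfl⟩
  by_contra hs
  apply hne
  rw [← one_smul E φ₁, ← inv_mul_cancel₀ hs, mul_smul, hst, smul_zero]

/-- **Two equivariant functionals separated by a filtration step make a two-dimensional representation admissible.** If
`dim_P V = 2` and `φ₁, φ₂ : V → B` are `P`-linear and `Γ`-equivariant with `φ₁ ≠ 0`, `φ₁(V) ⊆ Fil^i B` and
`φ₂(m) ∉ Fil^i B` for some `m`, then `V` is `𝔅`-admissible (for `𝔅 = B_dR`: de Rham). This is the abstract form of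
Fontaine's theorem "`V_p` of an elliptic curve / of a `p`-divisible group of height 2 and dimension 1 is de Rham" once the
two periods `∫ω ∈ Fil¹ B_dR` and `∫η ∉ Fil¹ B_dR` are constructed. [cite: Fontaine1982FormesDifferentielles, §5]
[cite: FontaineAsterisque223III, Exp. III Thm. 1.5.2] -/
theorem isAdmissible_of_pair_of_fil [FiniteDimensional P M] (h2 : Module.finrank P M = 2)
    {φ₁ φ₂ : M →ₗ[P] 𝔅.B} (h₁ : ∀ σ m, φ₁ (ρ σ m) = σ • φ₁ m) (h₂ : ∀ σ m, φ₂ (ρ σ m) = σ • φ₂ m)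
    {i : ℤ} (hfil : ∀ m, φ₁ m ∈ 𝔅.fil i) (hne : φ₁ ≠ 0) (hnot : ∃ m, φ₂ m ∉ 𝔅.fil i) :
    𝔅.IsAdmissible ρ :=
  𝔅.isAdmissible_of_equivariant ρ h2 (Φ := ![φ₁, φ₂])
    (fun k σ m => by fin_cases k <;> simp [h₁ σ m, h₂ σ m]) (𝔅.linearIndependent_pair_of_fil hfil hne hnot)

end PeriodHoms

end Literature.NumberTheory.GaloisRepresentations.PeriodRingData

/-! ## §2 Elliptic curves: `V_pW|_{Γ_F}` is de Rham as soon as it carries two separated period homomorphisms -/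

namespace Literature.NumberTheory.PAdicHodge

open Literature Literature.NumberTheory.GaloisRepresentations Literature.NumberTheory.EllipticCurves WeierstrassCurve
open Literature.NumberTheory.GaloisRepresentations.IsNonarchimedeanLocalField Field ValuativeRel

/-- **Extension of a `ℤ_p`-homogeneous additive map on `T_pA` to a `ℚ_p`-linear map on `V_pA = ℚ_p ⊗_{ℤ_p} T_pA`**
with `Φ(c ⊗ a) = c • φ(a)` (`N` any `ℚ_p`-vector space; Mathlib `LinearMap.liftBaseChange` for the `ℤ_p`-module structure
on `N` by restriction of scalars; `V_p = T_p ⊗ ℚ_p`, Serre 1968, I.1.1). [cite: Serre1968, Ch. I §1.1] -/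
theorem exists_linearMap_rationalTateModule_of_padicInt_smul {A : Type*} [AddCommGroup A] {p : ℕ} [Fact p.Prime]
    {N : Type*} [AddCommGroup N] [Module ℚ_[p] N] (φ : TateModule A p →+ N)
    (hφ : ∀ (c : ℤ_[p]) (a : TateModule A p), φ (c • a) = (c : ℚ_[p]) • φ a) :
    ∃ Φ : RationalTateModule A p →ₗ[ℚ_[p]] N, ∀ (c : ℚ_[p]) (a : TateModule A p),
      Φ ((c ⊗ₜ[ℤ_[p]] a : ℚ_[p] ⊗[ℤ_[p]] TateModule A p) : RationalTateModule A p) = c • φ a := by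
  letI : Module ℤ_[p] N := Module.compHom N (algebraMap ℤ_[p] ℚ_[p])
  haveI : IsScalarTower ℤ_[p] ℚ_[p] N := IsScalarTower.of_algebraMap_smul fun _ _ => rfl
  let φℓ : TateModule A p →ₗ[ℤ_[p]] N :=
    { toFun := φ
      map_add' := φ.map_add
      map_smul' := fun c a => by rw [hφ]; rfl }
  exact ⟨(φℓ.liftBaseChange ℚ_[p] : ℚ_[p] ⊗[ℤ_[p]] TateModule A p →ₗ[ℚ_[p]] N),
    fun c a => LinearMap.liftBaseChange_tmul ℚ_[p] φℓ c a⟩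

section Generic

variable {F : Type} [Field F] {p : ℕ} [Fact p.Prime] [Algebra ℚ_[p] F]
  (𝔅 : PeriodRingData.{0, 0, 0, 0} (absoluteGaloisGroup F) ℚ_[p] F)
  {A : Type} [AddCommGroup A] (ρ : GaloisRep F ℚ_[p] (RationalTateModule A p))
  (act : absoluteGaloisGroup F → TateModule A p → TateModule A p)

/-- **Equivariant extension.** For a representation `ρ` of `Γ_F` on `V_pA` induced by `act` on the lattice
(`ρ(σ)(c ⊗ a) = c ⊗ act σ a`; e.g. `rationalTateRep`, `restrictedRationalTateRep`) and `φ : T_pA →+ B` additive,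
`ℤ_p`-homogeneous and equivariant (`φ(act σ a) = σ(φ a)`), `φ` extends to a `ℚ_p`-linear `Γ_F`-EQUIVARIANT functional `Φ`
on `V_pA` with `Φ(1 ⊗ a) = φ(a)` (`V_p = T_p ⊗ ℚ_p` with the extended action, Serre 1968, I.1.1–1.2).
[cite: Serre1968, Ch. I §1.1–1.2] -/
theorem exists_equivariant_extend_rationalTateModule
    (hρ : ∀ (σ : absoluteGaloisGroup F) (c : ℚ_[p]) (a : TateModule A p),
      ρ σ ((c ⊗ₜ[ℤ_[p]] a : ℚ_[p] ⊗[ℤ_[p]] TateModule A p) : RationalTateModule A p) =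
        ((c ⊗ₜ[ℤ_[p]] act σ a : ℚ_[p] ⊗[ℤ_[p]] TateModule A p) : RationalTateModule A p))
    (φ : TateModule A p →+ 𝔅.B) (hφ : ∀ (c : ℤ_[p]) (a : TateModule A p), φ (c • a) = (c : ℚ_[p]) • φ a)
    (hσ : ∀ (σ : absoluteGaloisGroup F) (a : TateModule A p), φ (act σ a) = σ • φ a) :
    ∃ Φ : RationalTateModule A p →ₗ[ℚ_[p]] 𝔅.B,
      (∀ a, Φ (TateModule.toRational p a) = φ a) ∧
        ∀ (σ : absoluteGaloisGroup F) (x : RationalTateModule A p), Φ (ρ σ x) = σ • Φ x := by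
  obtain ⟨Φ, hΦ⟩ := exists_linearMap_rationalTateModule_of_padicInt_smul φ hφ
  refine ⟨Φ, fun a => ?_, fun σ x => ?_⟩
  · have h := hΦ 1 a
    rwa [one_smul] at h
  · -- run the tensor induction on the underlying type `ℚ_p ⊗ T_pA` of the synonym `RationalTateModule A p`
    let G : ℚ_[p] ⊗[ℤ_[p]] TateModule A p →+ 𝔅.B := Φ.toAddMonoidHom.comp (ρ σ).toAddMonoidHom
    let G' : ℚ_[p] ⊗[ℤ_[p]] TateModule A p →+ 𝔅.B := (DistribSMul.toAddMonoidHom 𝔅.B σ).comp Φ.toAddMonoidHom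
    change G x = G' x
    induction x using TensorProduct.induction_on with
    | zero => rw [map_zero, map_zero]
    | add x y hx hy => rw [map_add, map_add, hx, hy]
    | tmul c a =>
        change Φ (ρ σ ((c ⊗ₜ[ℤ_[p]] a : ℚ_[p] ⊗[ℤ_[p]] TateModule A p) : RationalTateModule A p)) =
          σ • Φ ((c ⊗ₜ[ℤ_[p]] a : ℚ_[p] ⊗[ℤ_[p]] TateModule A p) : RationalTateModule A p)
        rw [hρ, hΦ, hΦ, hσ]
        exact (smul_comm σ c (φ a)).symm

/-- A `ℚ_p`-linear functional on `V_pA` whose restriction to the lattice `T_pA` takes values in an `F`-submodule `S ≤ B`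
takes all its values in `S` (`V_pA` is generated by `1 ⊗ T_pA` over `ℚ_p ⊆ F`; Serre 1968, I.1.1). [cite: Serre1968, Ch. I §1.1] -/
theorem apply_mem_of_forall_toRational_mem (Φ : RationalTateModule A p →ₗ[ℚ_[p]] 𝔅.B) (S : Submodule F 𝔅.B)
    (hS : ∀ a : TateModule A p, Φ (TateModule.toRational p a) ∈ S) (x : RationalTateModule A p) : Φ x ∈ S := by
  let G : ℚ_[p] ⊗[ℤ_[p]] TateModule A p →+ 𝔅.B := Φ.toAddMonoidHom
  change G x ∈ S.toAddSubgroup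
  induction x using TensorProduct.induction_on with
  | zero => rw [map_zero]; exact zero_mem _
  | add x y hx hy => rw [map_add]; exact add_mem hx hy
  | tmul c a =>
      have h1 : ((c ⊗ₜ[ℤ_[p]] a : ℚ_[p] ⊗[ℤ_[p]] TateModule A p) : RationalTateModule A p) =
          c • TateModule.toRational p a := by
        rw [TateModule.toRational_apply]
        change _ = ((c • ((1 : ℚ_[p]) ⊗ₜ[ℤ_[p]] a) : ℚ_[p] ⊗[ℤ_[p]] TateModule A p) : RationalTateModule A p)
        rw [TensorProduct.smul_tmul', smul_eq_mul, mul_one]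
      change Φ ((c ⊗ₜ[ℤ_[p]] a : ℚ_[p] ⊗[ℤ_[p]] TateModule A p) : RationalTateModule A p) ∈ S
      rw [h1, map_smul, ← algebraMap_smul F c (Φ _)]
      exact S.smul_mem _ (hS a)

/-- **Admissibility of `V_pA` from two separated period homomorphisms on the lattice `T_pA`**: `ρ` on the
`2`-dimensional `V_pA` induced by `act`, `φ₁ φ₂ : T_pA →+ B` additive, `ℤ_p`-homogeneous, equivariant, `φ₁ ≠ 0`,
`φ₁(T_pA) ⊆ Fil^i`, `φ₂(a) ∉ Fil^i` for some `a` ⇒ `ρ` is `𝔅`-admissible (`PeriodRingData.isAdmissible_of_pair_of_fil` on the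
equivariant extensions). [cite: Fontaine1982FormesDifferentielles, §5] [cite: FontaineAsterisque223III, Exp. III Thm. 1.5.2] -/
theorem isAdmissible_rationalTateModule_of_periodHoms [Module.Finite ℚ_[p] (RationalTateModule A p)]
    (h2 : Module.finrank ℚ_[p] (RationalTateModule A p) = 2)
    (hρ : ∀ (σ : absoluteGaloisGroup F) (c : ℚ_[p]) (a : TateModule A p),
      ρ σ ((c ⊗ₜ[ℤ_[p]] a : ℚ_[p] ⊗[ℤ_[p]] TateModule A p) : RationalTateModule A p) =
        ((c ⊗ₜ[ℤ_[p]] act σ a : ℚ_[p] ⊗[ℤ_[p]] TateModule A p) : RationalTateModule A p))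
    (φ₁ φ₂ : TateModule A p →+ 𝔅.B)
    (hφ₁ : ∀ (c : ℤ_[p]) (a : TateModule A p), φ₁ (c • a) = (c : ℚ_[p]) • φ₁ a)
    (hφ₂ : ∀ (c : ℤ_[p]) (a : TateModule A p), φ₂ (c • a) = (c : ℚ_[p]) • φ₂ a)
    (hσ₁ : ∀ (σ : absoluteGaloisGroup F) (a : TateModule A p), φ₁ (act σ a) = σ • φ₁ a)
    (hσ₂ : ∀ (σ : absoluteGaloisGroup F) (a : TateModule A p), φ₂ (act σ a) = σ • φ₂ a)
    {i : ℤ} (hfil : ∀ a, φ₁ a ∈ 𝔅.fil i) (hne : ∃ a, φ₁ a ≠ 0) (hnot : ∃ a, φ₂ a ∉ 𝔅.fil i) :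
    𝔅.IsAdmissible ρ := by
  obtain ⟨Φ₁, hΦ₁, hΦ₁σ⟩ := exists_equivariant_extend_rationalTateModule 𝔅 ρ act hρ φ₁ hφ₁ hσ₁
  obtain ⟨Φ₂, hΦ₂, hΦ₂σ⟩ := exists_equivariant_extend_rationalTateModule 𝔅 ρ act hρ φ₂ hφ₂ hσ₂
  obtain ⟨a₁, ha₁⟩ := hne
  obtain ⟨a₂, ha₂⟩ := hnot
  refine 𝔅.isAdmissible_of_pair_of_fil ρ h2 hΦ₁σ hΦ₂σ (i := i)
    (apply_mem_of_forall_toRational_mem 𝔅 Φ₁ (𝔅.fil i) fun a => by rw [hΦ₁]; exact hfil a)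
    (fun h0 => ha₁ ?_) ⟨TateModule.toRational p a₂, by rwa [hΦ₂]⟩
  rw [← hΦ₁ a₁, h0, LinearMap.zero_apply]

end Generic

section Elliptic

variable {F : Type} [Field F] [ValuativeRel F] [TopologicalSpace F] [IsNonarchimedeanLocalField F] [CharZero F]
  {p : ℕ} [Fact p.Prime] [Fact (¬ IsUnit (p : integerC F))] [IsAdicComplete (Ideal.span {(p : integerC F)}) (integerC F)]
  (hp : valuation F p < 1) [Algebra ℚ_[p] F]

/-- **`V_pE` is de Rham from two separated period homomorphisms** (elliptic curve `E` OVER the `p`-adic field `F`):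
`φ₁ φ₂ : T_pE →+ B_dR(F)` additive, `ℤ_p`-homogeneous, `Γ_F`-equivariant, `φ₁ ≠ 0`, `φ₁(T_pE) ⊆ Fil¹`, `φ₂(τ) ∉ Fil¹` for
some `τ` (intended: `∫ω`, `∫η` through the matching `T_pE ≅ T_pÊ(𝒪_ℂ)`) ⇒ `rationalTateRep E p` is de Rham for
`bdRPeriodRingData hp` (`dim V_pE = 2`: `finrank_rationalTateModule_eq_two_holds`). [cite: Fontaine1982FormesDifferentielles, §5]
[cite: FontaineAsterisque223III, Exp. III Thm. 1.5.2] [cite: SilvermanAEC2009, Prop. III.7.1(a) with Remark 7.2] -/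
theorem isDeRham_rationalTateRep_of_periodHoms (E : WeierstrassCurve F) [E.IsElliptic]
    (φ₁ φ₂ : E.tateModule p →+ (bdRPeriodRingData (F := F) (p := p) hp).B)
    (hφ₁ : ∀ (c : ℤ_[p]) (a : E.tateModule p), φ₁ (c • a) = (c : ℚ_[p]) • φ₁ a)
    (hφ₂ : ∀ (c : ℤ_[p]) (a : E.tateModule p), φ₂ (c • a) = (c : ℚ_[p]) • φ₂ a)
    (hσ₁ : ∀ (σ : absoluteGaloisGroup F) (a : E.tateModule p), φ₁ (σ • a) = σ • φ₁ a)
    (hσ₂ : ∀ (σ : absoluteGaloisGroup F) (a : E.tateModule p), φ₂ (σ • a) = σ • φ₂ a)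
    (hfil : ∀ a, φ₁ a ∈ (bdRPeriodRingData (F := F) (p := p) hp).fil 1) (hne : ∃ a, φ₁ a ≠ 0)
    (hnot : ∃ a, φ₂ a ∉ (bdRPeriodRingData (F := F) (p := p) hp).fil 1) :
    GaloisRep.IsDeRham (bdRPeriodRingData (F := F) (p := p) hp) (rationalTateRep E p) := by
  have hpF : (p : F) ≠ 0 := Nat.cast_ne_zero.mpr (Fact.out : p.Prime).ne_zero
  haveI : Module.Finite ℚ_[p] (E.rationalTateModule p) := module_finite_rationalTateModule_holds E p
  exact isAdmissible_rationalTateModule_of_periodHoms (bdRPeriodRingData (F := F) (p := p) hp) (rationalTateRep E p)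
    (fun σ a => σ • a) (finrank_rationalTateModule_eq_two_holds E p hpF) (fun _ _ _ => rfl)
    φ₁ φ₂ hφ₁ hφ₂ hσ₁ hσ₂ hfil hne hnot

/-- **`V_pW|_{Γ_F}` is de Rham from two separated period homomorphisms** (`W` over a SUBFIELD `K₀ ⊆ F`, `char K₀ = 0`;
the vocabulary of the cite-only fact `isDeRham_restrictedRationalTateRep`): `φ₁ φ₂ : T_pW →+ B_dR(F)` additive,
`ℤ_p`-homogeneous, `Γ_F`-equivariant through `absGaloisRestrict K₀ F`, `φ₁ ≠ 0`, `φ₁(T_pW) ⊆ Fil¹`, `φ₂(τ) ∉ Fil¹` for some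
`τ` ⇒ `restrictedRationalTateRep W F p` is de Rham (equivalently work with `W ×_{K₀} F`, `isDeRham_rationalTateRep_of_periodHoms`
and the tree's `isDeRham_restrictedRationalTateRep_iff_baseChange`). Assembly step (A6) of "hDR at supersingular reduction via
the two `p`-adic periods"; BSD is not proved by this. [cite: Fontaine1982FormesDifferentielles, §5]
[cite: FontaineAsterisque223III, Exp. III Thm. 1.5.2] [cite: SilvermanAEC2009, Prop. III.7.1(a) with Remark 7.2] -/
theorem isDeRham_restrictedRationalTateRep_of_periodHoms {K₀ : Type} [Field K₀] [CharZero K₀]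
    (W : WeierstrassCurve K₀) [W.IsElliptic] [Algebra K₀ F]
    (φ₁ φ₂ : W.tateModule p →+ (bdRPeriodRingData (F := F) (p := p) hp).B)
    (hφ₁ : ∀ (c : ℤ_[p]) (a : W.tateModule p), φ₁ (c • a) = (c : ℚ_[p]) • φ₁ a)
    (hφ₂ : ∀ (c : ℤ_[p]) (a : W.tateModule p), φ₂ (c • a) = (c : ℚ_[p]) • φ₂ a)
    (hσ₁ : ∀ (σ : absoluteGaloisGroup F) (a : W.tateModule p), φ₁ (absGaloisRestrict K₀ F σ • a) = σ • φ₁ a)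
    (hσ₂ : ∀ (σ : absoluteGaloisGroup F) (a : W.tateModule p), φ₂ (absGaloisRestrict K₀ F σ • a) = σ • φ₂ a)
    (hfil : ∀ a, φ₁ a ∈ (bdRPeriodRingData (F := F) (p := p) hp).fil 1) (hne : ∃ a, φ₁ a ≠ 0)
    (hnot : ∃ a, φ₂ a ∉ (bdRPeriodRingData (F := F) (p := p) hp).fil 1) :
    GaloisRep.IsDeRham (bdRPeriodRingData (F := F) (p := p) hp) (restrictedRationalTateRep W F p) := by
  have hpK : (p : K₀) ≠ 0 := Nat.cast_ne_zero.mpr (Fact.out : p.Prime).ne_zero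
  haveI : Module.Finite ℚ_[p] (W.rationalTateModule p) := module_finite_rationalTateModule_holds W p
  exact isAdmissible_rationalTateModule_of_periodHoms (bdRPeriodRingData (F := F) (p := p) hp)
    (restrictedRationalTateRep W F p) (fun σ a => absGaloisRestrict K₀ F σ • a)
    (finrank_rationalTateModule_eq_two_holds W p hpK) (fun _ _ _ => rfl) φ₁ φ₂ hφ₁ hφ₂ hσ₁ hσ₂ hfil hne hnot

end Elliptic

end Literature.NumberTheory.PAdicHodge

end
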